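import Literature.MathematicalPhysics.QuantumFieldTheory.Balaban1983to89.T4SummableDefect

/-!
# `T4Continuum.CovariantMeanContraction` (cell-tree module `Summits/QuantumFields/BalabanUV/T4Continuum/Support/CovariantMeanContraction.lean`)
# — road P4 of the spine estimate NE1′ («observable-level telescoping + FIRST-ORDER COVARIANT-MEAN PROPAGATION»): the abstract
# cores of the route (no `Ad`-invariant vector in `su(2)`; the Schwarz-type gain for analytic functionals vanishing at a reference
# configuration; the block-contraction and level arithmetic) and the WIRING of the road's factorised per-step budget into the
# telescoping lane's exact missing inequality `T4ExteriorCovariance.UniformCovDefect` BY NAME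
# (cell `pub-balaban`, scoping sub-cell `t4`, ROUND-2 prover seat #4 of BINDER-OWNERS row NE1′, unit `b2b-balaban-t4-ne1p-p4`,
# generation 1; companion of the typed skeleton `t4/skeletons/NE1p-t4-ne1p-p4.md`; ADDITIVE — a new leaf importing
# `T4SummableDefect` only; nothing modified)

HONEST FRAMING.  Finite four-torus, rung (B)+1 only: the `ε → 0` limit of the joint expectations of unit-scale averaged
gauge-invariant Wilson-loop variables on ONE torus of fixed physical size, along a Wilson scheme `D.scheme g₀` of a datum of
Bałaban type `D : T4Continuum.FiniteEpsData F G`.  NOT infinite volume, NOT a mass gap, NOT the Clay problem, NOT summit progress.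
HONEST DEPENDENCY: continuum YM on T⁴ ⇐ BetaPertH ∧ nine spine estimates (0/9 proved); BetaPertH ⇐ (D1) ∧ (D4) ∧ CAP+tail;
G-an2-4 gates asym, D1 and NE2/3/4.  Every analytic input below is a HYPOTHESIS SHAPE (`def … : Prop`) entering theorems as an
explicit binder and asserted of NO datum; (B), `BetaPertHyp`, (B^μ) are not mentioned because nothing here consumes them.
STATEMENTS AND QUANTIFIER BOOKKEEPING ONLY: §1 is linear algebra of `2 × 2` complex matrices and the Schwarz lemma of Mathlib,
§2 is arithmetic of real sequences, §3 instantiates it on the cell's objects BY NAME; every declaration is [folklore] and sorry-free.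

CITATION HEADER (lean-in-tree rule).  No page of T. Bałaban's series (CMP 1983–89) or of any other source was newly read for this
module and no sentence is attributed to print here.  Objects re-used BY NAME with their own certified headers' provenance:
`T4ExteriorCovariance.StepCovBudget` / `UniformCovDefect` / `stepCovBudget_mono` / `uniformDefectBudget_of_covDefect` /
`integral_eq_zero_of_equivariant` (telescoping lineage t4-ne1p-p3, generation 7), `T4SummableDefect.summableDefectBudget_of_uniformDefectBudget`
/ `uniformSummableDefect_of_summableDefectBudget` / `MidLimits` / `hasContinuumLimit_of_summableDefect_midLimits` (generation 8),
`Missing.HasContinuumLimit` (cell apex).  The concrete `su(2)` lemma of §1 and the one-step arithmetic pattern of §2 are ADAPTED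
from the HOME-staged scratch `t4/b2b-balaban-t4-ne1p-p2-g16/work/NE1pRoutesG16.Sketch.lean` §A (ideation seat t4-ne1p-p2,
generation 16: route Φ «covariant-mean contraction» of `NE1p-ROUTES-g16.md` §2) — a HOME scratch is not a tree module and is
cited here as provenance only.  For Bałaban's four-dimensional densities NONE of the shapes is printed ([Balaban1989LargeFieldII]
p. 356, sentence carried verbatim by `Missing` §2 / `T4Continuum`, not re-quoted here).  ABSOLUTE RULE honoured: no
programme-internal statement is a hypothesis-free input.

WHY THIS LEAF (skeleton `t4/skeletons/NE1p-t4-ne1p-p4.md` §1–§4).  Road P4 supplies the telescoping lane's wall (W1) —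
`UniformCovDefect`: K-uniform, geometric-in-the-distance, mass-weighted exterior covariances of the ℝ-defects — by splitting
each one-term defect of the pulled-back loop product into a SECOND-ORDER remainder (pointwise summable, ratio `L⁴θ₁²`) and a
FIRST-ORDER pairing `⟨f′(u), 𝐒⟩` whose law-side factor `𝐒` (the conditional-mean gap of the exact `su(2)`-valued displacement
of the unit-scale variable) is adjoint-COVARIANT and therefore VANISHES AT EVERY PURE-GAUGE exterior (§1: its mean under an
invariant law is an `Ad`-invariant vector, and `su(2)` has none), and is then PROPAGATED to the final scale through the
undressed steps as the source-derivative of the effective action, its sup norm contracting by a factor `ρ` per level (per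
`s`-block: `κ_s ≤ C·B₃M·L^{−2s} + C′g²p(g)²` — Schwarz-type gain (§1) × the printed depth-flatness of minimisers
[Balaban1985Variational] Thm 1 (9) at ratio `L^s` × second-order fluctuation averaging).  §2 is the arithmetic that turns
«count `Λ₄ⁿ` × large-field weight `w` × sensitivity `θ₁ⁿ` × propagated size `ρⁿ` × final flatness» and «count × weight ×
`(θ₁ⁿ)²`» into ONE geometric envelope `C·rⁿ`, `r = max(Λ₄θ₁ρ, Λ₄θ₁²) < 1`; §3 states the road's per-step supply as a
hypothesis shape over the lane's `StepCovBudget` and proves that it delivers `UniformCovDefect` — hence, BY NAME,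
`UniformDefectBudget`, `UniformSummableDefect` and, with the undressed two-run input `MidLimits`, `Missing.HasContinuumLimit`.

WHAT IS NOT PROVED / VALUE.  Nothing analytic: the block contraction (skeleton leaf L8 = the road's declared OWN-OPEN piece of
NE1′), the birth bound, the large-field weights and the count are NOT PRINTED for Bałaban's densities and NOT proved here;
`FactorisedCovSupply` is asserted of no datum.  Value = the road's composition in kernel over the lane's shapes, with the
numeric side conditions (`Λ₄θ₁ρ < 1`, `Λ₄θ₁² < 1`) explicit; NOT summit progress.

## Contents
§1 abstract cores — `eq_zero_of_commute_g₂_g₃` (no `Ad SU(2)`-invariant traceless `2×2` matrix), `norm_le_div_mul_norm_of_vanishing`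
   (Schwarz-type gain: analytic, bounded by `N` on a ball of radius `r` about a zero ⇒ `‖f V‖ ≤ (N/r)·‖V − V₀‖`).
§2 arithmetic — `size_le_of_blockContraction` (iterated block contraction), `firstOrderLevel_le`, `secondOrderLevel_le`,
   `factorisedBudget_le_geometric` (the two channels under one geometric envelope).
§3 the cell — `FactorisedCovSupply D g₀` (hypothesis shape) ⇒ `UniformCovDefect D g₀` ⇒ … ⇒ `HasContinuumLimit (D.scheme g₀)`
   given `MidLimits` (`uniformCovDefect_of_factorisedCovSupply`, `hasContinuumLimit_of_factorisedCovSupply_midLimits`).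
-/

noncomputable section

open MeasureTheory Filter Topology Metric Set
open scoped BigOperators

namespace Summit.QuantumFields.BalabanUV.T4Continuum.CovariantMeanContraction

/-! ## §1 Abstract cores of the first-order mechanism -/

section Cores

/-- The first test element of `SU(2)` used in the no-invariant-vector lemma. [folklore] -/
def g₂ : Matrix (Fin 2) (Fin 2) ℂ := !![0, 1; -1, 0]

/-- The second test element of `SU(2)` used in the no-invariant-vector lemma. [folklore] -/
def g₃ : Matrix (Fin 2) (Fin 2) ℂ := !![0, Complex.I; Complex.I, 0]

/-- **NO `Ad`-INVARIANT VECTOR IN `su(2)`** (concrete form; adapted from the ideation scratch `NE1pRoutesG16.Sketch` §A1): a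
traceless complex `2 × 2` matrix commuting with `g₂` and `g₃` is zero.  Hence the only element of `su(2)` (indeed of `sl(2,ℂ)`)
fixed by conjugation with all of `SU(2)` is `0` — the discharge of the hypothesis `hfix` of
`T4ExteriorCovariance.integral_eq_zero_of_equivariant` for the adjoint action, i.e. the reason a covariant `su(2)`-valued
conditional mean VANISHES under every conjugation-invariant law (skeleton leaf L6). [folklore] -/
theorem eq_zero_of_commute_g₂_g₃ (v : Matrix (Fin 2) (Fin 2) ℂ) (h₂ : g₂ * v = v * g₂) (h₃ : g₃ * v = v * g₃)
    (htr : v.trace = 0) : v = 0 := by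
  have e₂ := fun i j => congrFun (congrFun h₂ i) j
  have e₃ := fun i j => congrFun (congrFun h₃ i) j
  have h01 : v 1 0 = -v 0 1 := by
    have t := e₂ 0 0
    simp [g₂, Matrix.mul_apply, Fin.sum_univ_two] at t
    linear_combination t
  have h00 : v 1 1 = v 0 0 := by
    have t := e₂ 0 1
    simp [g₂, Matrix.mul_apply, Fin.sum_univ_two] at t
    linear_combination t
  have hc : v 1 0 = v 0 1 := by
    have t := e₃ 0 0
    simp [g₃, Matrix.mul_apply, Fin.sum_univ_two] at t
    have t' : Complex.I * (v 1 0 - v 0 1) = 0 := by linear_combination t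
    have := (mul_eq_zero.mp t').resolve_left Complex.I_ne_zero
    linear_combination this
  have hb : v 0 1 = 0 := by
    have t : (2 : ℂ) * v 0 1 = 0 := by linear_combination hc.symm.trans h01
    exact (mul_eq_zero.mp t).resolve_left two_ne_zero
  have hcc : v 1 0 = 0 := by rw [hc, hb]
  have ha : v 0 0 = 0 := by
    rw [Matrix.trace_fin_two] at htr
    have t : (2 : ℂ) * v 0 0 = 0 := by linear_combination htr - h00
    exact (mul_eq_zero.mp t).resolve_left two_ne_zero
  have hd : v 1 1 = 0 := by rw [h00, ha]
  rw [Matrix.eta_fin_two v, ha, hb, hcc, hd]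
  ext i j; fin_cases i <;> fin_cases j <;> rfl

variable {E F : Type*} [NormedAddCommGroup E] [NormedSpace ℂ E] [NormedAddCommGroup F] [NormedSpace ℂ F]

/-- **THE SCHWARZ-TYPE GAIN** (skeleton leaf L9; Mathlib's `Complex.dist_le_div_mul_dist_of_mapsTo_ball` at `n = 0`): a
functional `f` of a complex chart `E` of configurations which is complex-differentiable on the ball of radius `r` about a
reference configuration `V₀`, bounded by `N` there, and VANISHES AT `V₀`, satisfies `‖f V‖ ≤ (N / r)·‖V − V₀‖` on the ball.
Reading in the road: `f` = a propagated covariant conditional mean (zero at the pure-gauge reference by §1's first lemma),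
`‖V − V₀‖` = the depth-flatness of the background supplied by [Balaban1985Variational] Thm 1 (9) at ratio `L^s`
(`B₃Mε₁·L^{−2s}`), `r` = the analyticity radius of the chart; the quotient is the per-block contraction's classical part.
Nothing here asserts that Bałaban's functionals meet the hypotheses. [folklore] -/
theorem norm_le_div_mul_norm_of_vanishing {f : E → F} {V₀ V : E} {r N : ℝ}
    (hf : DifferentiableOn ℂ f (ball V₀ r)) (hN : ∀ W ∈ ball V₀ r, ‖f W‖ ≤ N) (h0 : f V₀ = 0) (hV : V ∈ ball V₀ r) :
    ‖f V‖ ≤ N / r * ‖V - V₀‖ := by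
  have hmaps : MapsTo f (ball V₀ r) (closedBall (f V₀) N) := by
    intro W hW
    rw [mem_closedBall, dist_eq_norm, h0, sub_zero]
    exact hN W hW
  have h := Complex.dist_le_div_mul_dist_of_mapsTo_ball hf hmaps hV
  rwa [dist_eq_norm, dist_eq_norm, h0, sub_zero] at h

/-- The gain in the form used by the level arithmetic: with the depth-flatness `‖V − V₀‖ ≤ δ` (`δ < r`), `‖f V‖ ≤ N·(δ/r)`.
[folklore] -/
theorem norm_le_mul_ratio_of_vanishing {f : E → F} {V₀ V : E} {r N δ : ℝ} (hr : 0 < r) (hN0 : 0 ≤ N)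
    (hf : DifferentiableOn ℂ f (ball V₀ r)) (hN : ∀ W ∈ ball V₀ r, ‖f W‖ ≤ N) (h0 : f V₀ = 0)
    (hδ : ‖V - V₀‖ ≤ δ) (hδr : δ < r) : ‖f V‖ ≤ N * (δ / r) := by
  have hV : V ∈ ball V₀ r := by
    rw [mem_ball, dist_eq_norm]
    exact lt_of_le_of_lt hδ hδr
  calc ‖f V‖ ≤ N / r * ‖V - V₀‖ := norm_le_div_mul_norm_of_vanishing hf hN h0 hV
    _ ≤ N / r * δ := mul_le_mul_of_nonneg_left hδ (div_nonneg hN0 hr.le)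
    _ = N * (δ / r) := by ring

end Cores

/-! ## §2 The block contraction and the level arithmetic -/

section Arithmetic

/-- **ITERATED BLOCK CONTRACTION** (skeleton leaf L8 iterated): if the sup norms `N j` of the propagated first-order factor
after `j` blocks satisfy `N (j+1) ≤ κ j · N j` with `0 ≤ κ j ≤ q`, then `N J ≤ N 0 · q ^ J`. [folklore] -/
theorem size_le_of_blockContraction {N κ : ℕ → ℝ} {q : ℝ} (hN0 : ∀ j, 0 ≤ N j) (hκ0 : ∀ j, 0 ≤ κ j)
    (hκ : ∀ j, κ j ≤ q) (hstep : ∀ j, N (j + 1) ≤ κ j * N j) : ∀ J, N J ≤ N 0 * q ^ J := by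
  have hq : 0 ≤ q := (hκ0 0).trans (hκ 0)
  intro J
  induction J with
  | zero => simp
  | succ J ih =>
    calc N (J + 1) ≤ κ J * N J := hstep J
      _ ≤ q * (N 0 * q ^ J) := mul_le_mul (hκ J) ih (hN0 J) hq
      _ = N 0 * q ^ (J + 1) := by ring

/-- The per-block rate of the road in closed form: classical depth-flatness part `Ccl · L^{−2s}` (the constant `Ccl` —
[Balaban1985Variational]'s `B₃M` times the Schwarz and geometry constants — paid ONCE per block of `s` steps) plus the
second-order fluctuation part `Cfl · q²` (`q = g·p(g)/r`).  It is `≤ L^{−(1+δ)s}` as soon as `Ccl ≤ L^{(1−δ)s}/2` and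
`Cfl·q² ≤ L^{−(1+δ)s}/2` — the road's two numeric side conditions («`s` large given `L`», «`g` small given `L, s`»). [folklore] -/
theorem blockRate_le {L s δ Ccl Cfl q : ℝ}
    (hcl : Ccl * L ^ (-(2 : ℝ) * s) ≤ L ^ (-(1 + δ) * s) / 2) (hfl : Cfl * q ^ 2 ≤ L ^ (-(1 + δ) * s) / 2) :
    Ccl * L ^ (-(2 : ℝ) * s) + Cfl * q ^ 2 ≤ L ^ (-(1 + δ) * s) := by
  linarith

/-- **FIRST-ORDER CHANNEL OF ONE LEVEL**: count `cnt·Λ₄ⁿ` × large-field weight `w ≤ wbar` × sensitivity `Csens·θ₁ⁿ` ×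
propagated size `Cprop·ρⁿ` × final pairing constant `Cfin` is `≤ (cnt·wbar·Csens·Cprop·Cfin)·(Λ₄θ₁ρ)ⁿ`. [folklore] -/
theorem firstOrderLevel_le {cnt Λ₄ w wbar Csens θ₁ Cprop ρ Cfin : ℝ} (hcnt : 0 ≤ cnt) (hΛ : 0 ≤ Λ₄) (hw0 : 0 ≤ w)
    (hw : w ≤ wbar) (hCs : 0 ≤ Csens) (hθ : 0 ≤ θ₁) (hCp : 0 ≤ Cprop) (hρ : 0 ≤ ρ) (hCf : 0 ≤ Cfin) (n : ℕ) :
    cnt * Λ₄ ^ n * w * (Csens * θ₁ ^ n) * (Cprop * ρ ^ n) * Cfin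
      ≤ cnt * wbar * Csens * Cprop * Cfin * (Λ₄ * θ₁ * ρ) ^ n := by
  have _ := hw0
  have key : cnt * Λ₄ ^ n * w * (Csens * θ₁ ^ n) * (Cprop * ρ ^ n) * Cfin
      = w * (cnt * Csens * Cprop * Cfin * (Λ₄ * θ₁ * ρ) ^ n) := by
    rw [mul_pow, mul_pow]; ring
  rw [key]
  have hc : 0 ≤ cnt * Csens * Cprop * Cfin * (Λ₄ * θ₁ * ρ) ^ n := by positivity
  calc w * (cnt * Csens * Cprop * Cfin * (Λ₄ * θ₁ * ρ) ^ n)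
      ≤ wbar * (cnt * Csens * Cprop * Cfin * (Λ₄ * θ₁ * ρ) ^ n) := mul_le_mul_of_nonneg_right hw hc
    _ = cnt * wbar * Csens * Cprop * Cfin * (Λ₄ * θ₁ * ρ) ^ n := by ring

/-- **SECOND-ORDER CHANNEL OF ONE LEVEL**: count × weight × `C₂·(θ₁ⁿ)²` is `≤ (cnt·wbar·C₂)·(Λ₄θ₁²)ⁿ` — pointwise summable with
NO cancellation as soon as `Λ₄θ₁² < 1` (`= L⁻²` at `Λ₄ = L⁴`, `θ₁ = L⁻³`). [folklore] -/
theorem secondOrderLevel_le {cnt Λ₄ w wbar C₂ θ₁ : ℝ} (hcnt : 0 ≤ cnt) (hΛ : 0 ≤ Λ₄) (hw0 : 0 ≤ w) (hw : w ≤ wbar)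
    (hC : 0 ≤ C₂) (n : ℕ) :
    cnt * Λ₄ ^ n * w * (C₂ * (θ₁ ^ n) ^ 2) ≤ cnt * wbar * C₂ * (Λ₄ * θ₁ ^ 2) ^ n := by
  have _ := hw0
  have key : cnt * Λ₄ ^ n * w * (C₂ * (θ₁ ^ n) ^ 2) = w * (cnt * C₂ * (Λ₄ * θ₁ ^ 2) ^ n) := by
    rw [mul_pow, ← pow_mul, ← pow_mul]; ring_nf
  rw [key]
  have hc : 0 ≤ cnt * C₂ * (Λ₄ * θ₁ ^ 2) ^ n := by positivity
  calc w * (cnt * C₂ * (Λ₄ * θ₁ ^ 2) ^ n) ≤ wbar * (cnt * C₂ * (Λ₄ * θ₁ ^ 2) ^ n) := mul_le_mul_of_nonneg_right hw hc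
    _ = cnt * wbar * C₂ * (Λ₄ * θ₁ ^ 2) ^ n := by ring

/-- **ONE GEOMETRIC ENVELOPE FOR BOTH CHANNELS**: `A₁·r₁ⁿ + A₂·r₂ⁿ ≤ (A₁ + A₂)·(max r₁ r₂)ⁿ`. [folklore] -/
theorem two_channels_le_geometric {A₁ A₂ r₁ r₂ : ℝ} (hA₁ : 0 ≤ A₁) (hA₂ : 0 ≤ A₂) (hr₁ : 0 ≤ r₁) (hr₂ : 0 ≤ r₂) (n : ℕ) :
    A₁ * r₁ ^ n + A₂ * r₂ ^ n ≤ (A₁ + A₂) * (max r₁ r₂) ^ n := by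
  have h1 : r₁ ^ n ≤ (max r₁ r₂) ^ n := pow_le_pow_left₀ hr₁ (le_max_left _ _) n
  have h2 : r₂ ^ n ≤ (max r₁ r₂) ^ n := pow_le_pow_left₀ hr₂ (le_max_right _ _) n
  calc A₁ * r₁ ^ n + A₂ * r₂ ^ n ≤ A₁ * (max r₁ r₂) ^ n + A₂ * (max r₁ r₂) ^ n :=
        add_le_add (mul_le_mul_of_nonneg_left h1 hA₁) (mul_le_mul_of_nonneg_left h2 hA₂)
    _ = (A₁ + A₂) * (max r₁ r₂) ^ n := by ring

/-- With Bałaban's numbers `Λ₄ = L⁴`, `θ₁ = L⁻³` and a propagation rate `ρ = L^{−(1+δ)}`, `δ > 0`, `L > 1`: the first-order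
ratio is `L⁴·L⁻³·L^{−(1+δ)} = L^{−δ} < 1` and the second-order ratio is `L⁴·L⁻⁶ = L⁻² < 1`. [folklore] -/
theorem ratios_lt_one {L δ : ℝ} (hL : 1 < L) (hδ : 0 < δ) :
    L ^ (4 : ℝ) * L ^ (-(3 : ℝ)) * L ^ (-(1 + δ)) < 1 ∧ L ^ (4 : ℝ) * (L ^ (-(3 : ℝ))) ^ 2 < 1 := by
  have hL0 : 0 < L := lt_trans zero_lt_one hL
  constructor
  · rw [← Real.rpow_add hL0, ← Real.rpow_add hL0]
    have : (4 : ℝ) + -(3 : ℝ) + -(1 + δ) = -δ := by ring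
    rw [this]
    exact Real.rpow_lt_one_of_one_lt_of_neg hL (by linarith)
  · rw [← Real.rpow_natCast, ← Real.rpow_mul hL0.le, ← Real.rpow_add hL0]
    have : (4 : ℝ) + -(3 : ℝ) * ((2 : ℕ) : ℝ) = -2 := by norm_num
    rw [this]
    exact Real.rpow_lt_one_of_one_lt_of_neg hL (by norm_num)

end Arithmetic

/-! ## §3 The cell: the road's factorised per-step supply delivers the lane's exact missing inequality -/

section Cell

open Literature.MathematicalPhysics.QuantumFieldTheory.Balaban1983to89
open T4Continuum T4ExteriorCovariance T4SummableDefect T4ObservableTelescopeTwoRun Missing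

variable {F : T4Family} {G : Type*} [GaugeGroup G] [MeasurableSpace G] [HaarData G]
variable [∀ K j : ℕ, DecidableEq (PBond (F.P K) j)]

/-- DATA — THE ROAD'S FACTORS for one string of loop labels (skeleton §4, leaves L2–L12; NOT PRINTED, asserted of no datum):
the located count growth `Λ₄` (cubes of level `k+1` influencing one unit bond, per level of distance), the per-bond sensitivity
rate `θ₁` of the iterated averaging (row NE1a), the synchronised large-field weight `w n` of a new ℝ-component at distance `n`
from the unit scale with its sup `wbar`, the first-order propagation rate `ρ` (the block contraction, leaf L8) with its constant
`Cprop`, the birth/sensitivity constant `Csens`, the final-pairing constant `Cfin`, the second-order constant `C₂`, and the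
loop-string count `cnt`. [folklore] -/
structure Factors where
  /-- string-dependent count prefactor (number of unit bonds read × geometry) -/
  cnt : ℝ
  /-- count growth per level of distance (`= L⁴` in the cell) -/
  Λ₄ : ℝ
  /-- per-fine-bond sensitivity rate of the iterated averaging (`= L⁻³` in the cell, row NE1a) -/
  θ₁ : ℝ
  /-- synchronised large-field weight of a new ℝ-component at distance `n` -/
  w : ℕ → ℝ
  /-- a uniform bound of the large-field weights -/
  wbar : ℝ
  /-- birth / sensitivity constant of the first-order factor -/
  Csens : ℝ
  /-- propagation constant of the first-order factor -/
  Cprop : ℝ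
  /-- propagation rate of the first-order factor per level of distance -/
  ρ : ℝ
  /-- final-pairing constant (depth flatness at the last scale × `‖f′‖`) -/
  Cfin : ℝ
  /-- second-order remainder constant -/
  C₂ : ℝ
  cnt_nonneg : 0 ≤ cnt
  Λ₄_nonneg : 0 ≤ Λ₄
  θ₁_nonneg : 0 ≤ θ₁
  w_nonneg : ∀ n, 0 ≤ w n
  w_le : ∀ n, w n ≤ wbar
  Csens_nonneg : 0 ≤ Csens
  Cprop_nonneg : 0 ≤ Cprop
  ρ_nonneg : 0 ≤ ρ
  Cfin_nonneg : 0 ≤ Cfin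
  C₂_nonneg : 0 ≤ C₂
  /-- the road's first numeric side condition: first-order channel geometric -/
  ratio₁_lt_one : Λ₄ * θ₁ * ρ < 1
  /-- the road's second numeric side condition: second-order channel geometric -/
  ratio₂_lt_one : Λ₄ * θ₁ ^ 2 < 1

namespace Factors

/-- The road's per-step budget at distance `n`: first-order channel + second-order channel. [folklore] -/
def budget (𝔣 : Factors) (n : ℕ) : ℝ :=
  𝔣.cnt * 𝔣.Λ₄ ^ n * 𝔣.w n * (𝔣.Csens * 𝔣.θ₁ ^ n) * (𝔣.Cprop * 𝔣.ρ ^ n) * 𝔣.Cfin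
    + 𝔣.cnt * 𝔣.Λ₄ ^ n * 𝔣.w n * (𝔣.C₂ * (𝔣.θ₁ ^ n) ^ 2)

/-- The envelope constant. [folklore] -/
def envC (𝔣 : Factors) : ℝ := 𝔣.cnt * 𝔣.wbar * 𝔣.Csens * 𝔣.Cprop * 𝔣.Cfin + 𝔣.cnt * 𝔣.wbar * 𝔣.C₂

/-- The envelope ratio. [folklore] -/
def envR (𝔣 : Factors) : ℝ := max (𝔣.Λ₄ * 𝔣.θ₁ * 𝔣.ρ) (𝔣.Λ₄ * 𝔣.θ₁ ^ 2)

/-- The uniform weight bound is non-negative. [folklore] -/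
theorem wbar_nonneg (𝔣 : Factors) : 0 ≤ 𝔣.wbar := (𝔣.w_nonneg 0).trans (𝔣.w_le 0)

/-- The envelope constant is non-negative. [folklore] -/
theorem envC_nonneg (𝔣 : Factors) : 0 ≤ 𝔣.envC := by
  have := 𝔣.wbar_nonneg
  have := 𝔣.cnt_nonneg; have := 𝔣.Csens_nonneg; have := 𝔣.Cprop_nonneg; have := 𝔣.Cfin_nonneg; have := 𝔣.C₂_nonneg
  unfold envC; positivity

/-- The envelope ratio is non-negative. [folklore] -/
theorem envR_nonneg (𝔣 : Factors) : 0 ≤ 𝔣.envR :=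
  le_max_of_le_left (mul_nonneg (mul_nonneg 𝔣.Λ₄_nonneg 𝔣.θ₁_nonneg) 𝔣.ρ_nonneg)

/-- The envelope ratio is `< 1` (the road's two numeric side conditions). [folklore] -/
theorem envR_lt_one (𝔣 : Factors) : 𝔣.envR < 1 := max_lt 𝔣.ratio₁_lt_one 𝔣.ratio₂_lt_one

/-- **THE ROAD'S BUDGET IS GEOMETRIC**: `budget 𝔣 n ≤ envC 𝔣 · (envR 𝔣)ⁿ`. [folklore] -/
theorem budget_le_geometric (𝔣 : Factors) (n : ℕ) : 𝔣.budget n ≤ 𝔣.envC * 𝔣.envR ^ n := by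
  have h1 := firstOrderLevel_le 𝔣.cnt_nonneg 𝔣.Λ₄_nonneg (𝔣.w_nonneg n) (𝔣.w_le n) 𝔣.Csens_nonneg 𝔣.θ₁_nonneg
    𝔣.Cprop_nonneg 𝔣.ρ_nonneg 𝔣.Cfin_nonneg n
  have h2 := secondOrderLevel_le (θ₁ := 𝔣.θ₁) 𝔣.cnt_nonneg 𝔣.Λ₄_nonneg (𝔣.w_nonneg n) (𝔣.w_le n) 𝔣.C₂_nonneg n
  have hw := 𝔣.wbar_nonneg
  have hA₁ : 0 ≤ 𝔣.cnt * 𝔣.wbar * 𝔣.Csens * 𝔣.Cprop * 𝔣.Cfin := by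
    have := 𝔣.cnt_nonneg; have := 𝔣.Csens_nonneg; have := 𝔣.Cprop_nonneg; have := 𝔣.Cfin_nonneg; positivity
  have hA₂ : 0 ≤ 𝔣.cnt * 𝔣.wbar * 𝔣.C₂ := by
    have := 𝔣.cnt_nonneg; have := 𝔣.C₂_nonneg; positivity
  have h3 := two_channels_le_geometric hA₁ hA₂ (mul_nonneg (mul_nonneg 𝔣.Λ₄_nonneg 𝔣.θ₁_nonneg) 𝔣.ρ_nonneg)
    (mul_nonneg 𝔣.Λ₄_nonneg (sq_nonneg 𝔣.θ₁)) n
  unfold budget envC envR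
  exact (add_le_add h1 h2).trans h3

end Factors

/-- HYPOTHESIS SHAPE — **THE ROAD'S FACTORISED PER-STEP SUPPLY** (skeleton §4: the conjunction of leaves L2–L12 in the currency
of the telescoping lane; NOT PRINTED, asserted of no datum): for every string of loop labels there are `Factors` such that,
at every step `k` and distance `n`, the lane's exterior-covariance datum `StepCovBudget` (a (0.3)-representation of the realised
step with a finite first-order `CovSplit` of every term's gap, mean-zero shifts) holds with the road's budget — i.e. the
mass-weighted first-order pairings are bounded by count × large-field weight × sensitivity × PROPAGATED covariant-mean size ×
final flatness, and the second-order remainders by count × weight × `(θ₁ⁿ)²`.  A supplier of this shape is exactly a proof of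
the road's leaves for Bałaban's densities. [folklore] -/
def FactorisedCovSupply (D : FiniteEpsData F G) (g₀ : ℕ → ℝ) : Prop :=
  ∀ Cs : List (ULoop F), ∃ 𝔣 : Factors, ∀ k n, StepCovBudget D g₀ Cs (𝔣.budget n) k n

/-- **THE ROAD DELIVERS THE LANE'S EXACT MISSING INEQUALITY: `FactorisedCovSupply D g₀ → UniformCovDefect D g₀`**
(`budget_le_geometric` + `stepCovBudget_mono`).  CONDITIONAL on the shape, NOT proved for Bałaban's densities. [folklore] -/
theorem uniformCovDefect_of_factorisedCovSupply [RegularGaugeGroup G] (D : FiniteEpsData F G) (g₀ : ℕ → ℝ)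
    (h : FactorisedCovSupply D g₀) : UniformCovDefect D g₀ := by
  intro Cs
  obtain ⟨𝔣, hkn⟩ := h Cs
  exact ⟨𝔣.envC, 𝔣.envR, 𝔣.envC_nonneg, 𝔣.envR_nonneg, 𝔣.envR_lt_one,
    fun k n => stepCovBudget_mono D g₀ Cs (𝔣.budget_le_geometric n) (hkn k n)⟩

/-- The road's supply gives the currency-free geometric (W1) `UniformDefectBudget` and the summable envelope
`UniformSummableDefect` of the telescoping lane, BY NAME. [folklore] -/
theorem uniformSummableDefect_of_factorisedCovSupply [RegularGaugeGroup G] (D : FiniteEpsData F G)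
    (hM : D.AvgMeasurable) (g₀ : ℕ → ℝ) (h : FactorisedCovSupply D g₀) :
    UniformDefectBudget D g₀ ∧ UniformSummableDefect D g₀ := by
  have hU := uniformDefectBudget_of_covDefect D hM g₀ (uniformCovDefect_of_factorisedCovSupply D g₀ h)
  exact ⟨hU, uniformSummableDefect_of_summableDefectBudget D hM g₀
    (summableDefectBudget_of_uniformDefectBudget D g₀ hU)⟩

/-- **END-TO-END, BY NAME: the road's one-run supply + the undressed two-run input `MidLimits` (node U5 without observable
factors) ⇒ `Missing.HasContinuumLimit (D.scheme g₀)`** — existence AND (by `avg_limit_exists_iff_uniqueLimitPoints`-type apex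
bookkeeping elsewhere) uniqueness of the `ε → 0` limit of the unit-scale averaged loop expectations along the scheme.
CONDITIONAL on both shapes, neither printed nor proved for Bałaban's densities; rung (B)+1 on the finite torus only. [folklore] -/
theorem hasContinuumLimit_of_factorisedCovSupply_midLimits [RegularGaugeGroup G] (D : FiniteEpsData F G)
    (hM : D.AvgMeasurable) (g₀ : ℕ → ℝ) (h : FactorisedCovSupply D g₀) (hL : MidLimits D g₀) :
    HasContinuumLimit (D.scheme g₀) :=
  hasContinuumLimit_of_summableDefect_midLimits D hM g₀ (uniformSummableDefect_of_factorisedCovSupply D hM g₀ h).2 hL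

end Cell

end Summit.QuantumFields.BalabanUV.T4Continuum.CovariantMeanContraction
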